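import Literature.MathematicalPhysics.QuantumLattice.KomaTasakiU1FieldBound
import HarnessLib

/-!
# Long-range order ⟹ sourced order `≥ √3 σ` under a symmetry-breaking field, `SU(2)` case:
# Koma–Tasaki 1993 Corollary 7.2 (ground states under field), finite volume with explicit constants

T. Koma, H. Tasaki, *Symmetry breaking in Heisenberg antiferromagnets*, Commun. Math. Phys. **158**
(1993) 191–214 (`KomaTasaki1993`, held as `paper:doi-10-1007-bf02097237`), §7, p. 209:

> An extra assumption needed in the improvement is
> i'') The ground state `Φ_Λ` is `SU(2)` invariant, i.e., we have `X^{(i)}_Λ Φ_Λ = 0` for `i = 1, 2, 3`.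
> **Corollary 7.2.** Assume that the conditions for Theorem 7.1 are valid, and we further have the
> `SU(2)` invariance as in the above i'') and the assumptions iv) and v) in Sect. 2.  Then we have
> `liminf_{B↓0} liminf_{Λ↑ℤ^d} N⁻¹ (Φ_Λ(B), O^{(1)}_Λ Φ_Λ(B)) ≥ √3 σ`.                        (7.3)

and its complete printed proof, p. 211: "Since the desired inequality (7.3) is trivial when `σ = 0`,
we assume `σ ≠ 0`.  Then, by combining Theorem 7.3 with Theorem 6.1, one immediately gets
Corollary 7.2."  Here `Φ_Λ(B)` is ANY ground state of the sourced Hamiltonian `H_Λ(B) = H_Λ - B O^{(1)}_Λ`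
(KT93 (2.6)), `σ` the long-range order (7.1) of the symmetric ground states `Φ_Λ`, and the volume limit
is taken FIRST.  (For the Heisenberg antiferromagnet this is the ground-state form of KT93 Corollary 1.1,
`m_s ≥ √3 σ`; p. 209: "We thus believe that the bound (7.3) is saturated in 'natural' systems with an
`SU(2)` invariance.")

## What this file proves (sorry-free, theorems only, no named facts)

Both ingredients of the printed two-line proof are tree theorems:

* "Theorem 7.3" = the FIELD TRANSFER (7.5) + (7.23)–(7.24) with an `N`-uniform constant, proved for every
  Koma–Tasaki `U1System` in `KomaTasakiU1FieldBound.lean` (`U1System.field_order_ge_xiState_of_card_ge`: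
  `Re⟨Φ_B, O^{(1)}Φ_B⟩ ≥ Re⟨Ξ^{(k)}, O^{(1)}Ξ^{(k)}⟩ - D_k/B`, `D_k = k 2^{k+1} h̄ r μ^{-k}`, under the size
  condition `k² 2^k ≤ μ^{2k} N`; seat `hubbard-cq-p4`);
* "Theorem 6.1" (the `SU(2)` moment characterisation giving `√3` in place of `√2`) enters through the
  trial-state bound of `KomaTasakiSSBOrderParameter.lean` (`SU2Datum.theorem_2_5_orderOne_fin`, and its
  double-limit form `theorem_2_5_orderOne_su2_holds`:
  `N⁻¹ Re⟨Ξ^{(k)}, O^{(1)}Ξ^{(k)}⟩ ≥ √3 μ o - ε` for `k ≥ k₀(ε)`, `N ≥ N₀(k)`).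

This file carries out the combination, i.e. KT93 Corollary 7.2 itself, over a `U1System` carrying an
`SU2Datum` (KT93 §2 iv), v): a third density `o^{(3)}_x` and generators `X^{(1)}, X^{(2)}` rotating
`(O^{(1)}, O^{(2)}, O^{(3)})` as a vector; `X^{(3)} = C_Λ`):

* `SU2Datum.field_order_ge_of_card_ge` (**Corollary 7.2 in finite volume, every `N`, `k ≥ 1`, `B > 0`,
  explicit constants**): for an LRO eigenstate `Φ` (KT94 iv) (2.17), LRO parameter `μ`, so `σ_Λ = μ o`)
  that is a ground state of `H_Λ` and is annihilated by `X^{(1)}, X^{(2)}` (i'')), and EVERY ground state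
  `Φ_B` of `H_Λ - B O^{(1)}_Λ`, under `k² 2^k ≤ μ^{2k} N`:
  `Re⟨Φ_B, O^{(1)}Φ_B⟩ ≥ x_k - D_k/B` with `x_k = Re⟨Ξ^{(k)}, O^{(1)}Ξ^{(k)}⟩ ≥ 0` and
  `((2k+1)/(2k) · x_k)^{2k} ≥ (3(μ o N)²)^k/(2k+1) - (8k²3^k + 8k³4^k + k²4^k) o^{2k} N^{2k-1}`;
* `komaTasakiSU2Field` (**(7.3) in `ε`–`N₀` form, UNIFORM over the class** `(μ, o, r ≤ r₀, h̄ ≤ h₀)`):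
  for every `B > 0` and `ε > 0` there is `N₀` with `N⁻¹ Re⟨Φ_B, O^{(1)}_Λ Φ_B⟩ ≥ √3 μ o - ε` for every
  such system on `N ≥ N₀` sites — i.e. `liminf_Λ N⁻¹(Φ_Λ(B), O^{(1)}_ΛΦ_Λ(B)) ≥ √3 σ` for EVERY `B > 0`
  (volume limit first), a fortiori the printed `liminf_{B↓0} liminf_Λ (…) ≥ √3 σ`;
* `komaTasakiSU2Field_seq`: the same along a sequence of lattices `N_j → ∞` (`∀ᶠ j`).

Hypotheses versus print.  KT93 i') (`U_ΛΦ_Λ = Φ_Λ`) / ii) / iii) / σ ≠ 0 / i'') are rendered, as in the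
`U(1)` file, by the tree's `IsLROEigenstate` (normalised common eigenvector of `H_Λ` and `C_Λ`, second
moments `⟨(O^{(1)})²⟩ = ⟨(O^{(2)})²⟩ ≥ (μ o N)²`, `0 < μ ≤ 1` — KT94 iv) (2.17)) plus `X^{(1)}Φ = X^{(2)}Φ = 0`;
the tree's `SU2Datum` records iv) and the vector relations v) but not the `su(2)` relations among the
`X^{(j)}` nor vi) `[H_Λ, X^{(j)}] = 0`, which the printed proof does not use either.  The error constants
are the tree's (explicit, not optimal; KT93 p. 213 "This estimate is far from being optimal").

Direction, as everywhere in this family: LRO of the symmetric ground state ⟹ response under the field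
(read contrapositively at fixed `B > 0`: a certified sourced one-point function below `√3 μ o - ε` on some
`N ≥ N₀` excludes LRO with parameter `μ`).  The converse is not a theorem
(`Literature.Barriers.HubbardSuperconductivity.SourcedOrderWithoutGroundStateLRO`).  Written for the
literature-typing row of cell `pub/hubbard-cq` (seat `hubbard-cq-lit-1`, KT93 source → tree table, row
"Thm 7.3 / Cor 7.2"); the `U(1)` row (`√2`, electron-pair condensation) is `komaTasakiU1Field_holds`.

## References
* T. Koma, H. Tasaki, Commun. Math. Phys. **158** (1993) 191–214, Corollary 7.2 (7.3) p. 209, proof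
  p. 211, Theorem 7.3 (7.11) and its proof (7.23)–(7.26) pp. 211–213, Theorem 6.1.
  [cite: KomaTasaki1993, Corollary 7.2]
* T. Koma, H. Tasaki, J. Stat. Phys. **76** (1994) 745–803, Theorem 2.5 (2.30) and the remark after it
  ("we replace `√2` with `√3` when the model has an `SU(2)` symmetry"). [cite: KomaTasaki1994, Theorem 2.5]
* H. Tasaki, J. Stat. Phys. **174** (2019) 735–761, Theorem 3.4. [cite: Tasaki2019Tower, Theorem 3.4]
-/

noncomputable section

open Complex Finset Filter
open scoped InnerProductSpace ComplexConjugate Topology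

namespace Literature.MathematicalPhysics.QuantumLattice.KomaTasaki

universe u v

/-! ### Corollary 7.2 in finite volume -/

namespace SU2Datum

variable {Λ : Type u} [Fintype Λ] [Nonempty Λ] {E : Type v} [NormedAddCommGroup E]
  [InnerProductSpace ℂ E] {S : U1System Λ E} (d : SU2Datum S)

/-- **KT93 Corollary 7.2 in finite volume with explicit constants** ("by combining Theorem 7.3 with
Theorem 6.1").  For a Koma–Tasaki `U(1)` system with an `SU(2)` datum, an LRO eigenstate `Φ` (KT94 iv),
parameter `μ`) that is a GROUND state of `H_Λ` and is annihilated by the generators `X^{(1)}, X^{(2)}`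
(KT93 i'')), every `k ≥ 1` with `k² 2^k ≤ μ^{2k} N`, every field `B > 0` and EVERY ground state `Φ_B` of
`H_Λ - B O^{(1)}_Λ`: with `x_k = Re⟨Ξ^{(k)}, O^{(1)}Ξ^{(k)}⟩` (the `U(1)` tower trial state (7.23)),
(a) `Re⟨Φ_B, O^{(1)}Φ_B⟩ ≥ x_k - (k 2^{k+1} h̄ r μ^{-k})/B` (Theorem 7.3: (7.5) + (7.24));
(b) `x_k ≥ 0`; (c) `((2k+1)/(2k)·x_k)^{2k} ≥ (3(μoN)²)^k/(2k+1) - (8k²3^k + 8k³4^k + k²4^k) o^{2k} N^{2k-1}`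
(Theorem 6.1 + (7.25)–(7.26), the `√3` trial bound).  Hence
`N⁻¹Re⟨Φ_B, O^{(1)}Φ_B⟩ ≥ (2k/(2k+1))(2k+1)^{-1/(2k)} √3 μ o (1 - O_k(N⁻¹))^{1/(2k)} - O_k((BN)⁻¹)`.
[cite: KomaTasaki1993, Corollary 7.2, proof p. 211; Theorem 7.3 (7.5), (7.23)–(7.26); Theorem 6.1] -/
theorem field_order_ge_of_card_ge [FiniteDimensional ℂ E] {Φ : E} {EΛ μ : ℝ}
    (hΦ : IsLROEigenstate S Φ EΛ μ) (hJ : ∀ a, d.J a Φ = 0)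
    (hground : ∀ ψ : E, ‖ψ‖ = 1 → EΛ ≤ (⟪ψ, S.hamiltonian ψ⟫_ℂ).re)
    {k : ℕ} (hk : 1 ≤ k) (hN : (k : ℝ) ^ 2 * 2 ^ k ≤ μ ^ (2 * k) * Fintype.card Λ)
    {B : ℝ} (hB : 0 < B) {ΦB : E} (hΦB : ‖ΦB‖ = 1)
    (hmin : ∀ ψ : E, ‖ψ‖ = 1 →
      (⟪ΦB, (S.hamiltonian - (B : ℂ) • S.order 0) ΦB⟫_ℂ).re ≤
        (⟪ψ, (S.hamiltonian - (B : ℂ) • S.order 0) ψ⟫_ℂ).re) :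
    (⟪S.xiState k Φ, S.order 0 (S.xiState k Φ)⟫_ℂ).re
          - ((k : ℝ) * 2 ^ (k + 1) * S.hbar * S.r / μ ^ k) / B
        ≤ (⟪ΦB, S.order 0 ΦB⟫_ℂ).re ∧
      0 ≤ (⟪S.xiState k Φ, S.order 0 (S.xiState k Φ)⟫_ℂ).re ∧
      (3 * (μ * S.obar * Fintype.card Λ) ^ 2) ^ k / (2 * k + 1)
          - (8 * (k : ℝ) ^ 2 * 3 ^ k + 8 * (k : ℝ) ^ 3 * 4 ^ k + (k : ℝ) ^ 2 * 4 ^ k)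
            * S.obar ^ (2 * k) * (Fintype.card Λ : ℝ) ^ (2 * k - 1)
        ≤ ((2 * k + 1) / (2 * k) * (⟪S.xiState k Φ, S.order 0 (S.xiState k Φ)⟫_ℂ).re)
          ^ (2 * k) := by
  classical
  exact ⟨S.field_order_ge_xiState_of_card_ge hΦ hground hk hN hB hΦB hmin,
    d.theorem_2_5_orderOne_fin hΦ hJ k hk⟩

end SU2Datum

/-! ### Corollary 7.2 as printed: the limit statement (7.3), `ε`–`N₀` form -/

/-- **KT93 Corollary 7.2 (7.3), in `ε`–`N₀` form UNIFORM over the class — PROVED.**  For all `μ`, `o`,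
bounds `r₀ ≥ r`, `h₀ ≥ h̄`, every field `B > 0` and every `ε > 0` there is `N₀` (depending only on these)
such that for EVERY Koma–Tasaki `U(1)` system with an `SU(2)` datum on a lattice with `N ≥ N₀` sites, every
GROUND state `Φ` of `H_Λ` with obscured symmetry breaking iv) (LRO parameter `μ`, `σ = μ o`) annihilated by
`X^{(1)}, X^{(2)}` (i'')), and EVERY ground state `Φ_B` of `H_Λ - B O^{(1)}_Λ`:
`N⁻¹ Re⟨Φ_B, O^{(1)}_Λ Φ_B⟩ ≥ √3 μ o - ε`.  Hence `liminf_Λ N⁻¹ (Φ_Λ(B), O^{(1)}_Λ Φ_Λ(B)) ≥ √3 σ` for every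
`B > 0` — the volume limit taken FIRST — and a fortiori the printed
`liminf_{B↓0} liminf_{Λ↑ℤ^d} N⁻¹ (Φ_Λ(B), O^{(1)}_Λ Φ_Λ(B)) ≥ √3 σ` (7.3).  Proof as printed: `k` from the
`√3` trial-state bound `theorem_2_5_orderOne_su2_holds` with `ε/2` (Theorem 6.1 + (7.25)–(7.26)), then
`N₀` large enough for the size condition `k² 2^k ≤ μ^{2k} N` and for `D_k/(BN) ≤ ε/2`,
`D_k = k 2^{k+1} h₀ r₀ μ^{-k}` (Theorem 7.3, `U1System.field_order_ge_xiState_of_card_ge`).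
[cite: KomaTasaki1993, Corollary 7.2 (7.3), proof p. 211] -/
theorem komaTasakiSU2Field (μ ob h₀ : ℝ) (r₀ : ℕ) {B ε : ℝ} (hB : 0 < B) (hε : 0 < ε) :
    ∃ N₀ : ℕ, ∀ {Λ : Type u} [Fintype Λ] [Nonempty Λ] {E : Type v} [NormedAddCommGroup E]
      [InnerProductSpace ℂ E] [FiniteDimensional ℂ E] (S : U1System Λ E) (d : SU2Datum S) (Φ : E)
      (EΛ : ℝ), IsLROEigenstate S Φ EΛ μ → (∀ a, d.J a Φ = 0) → S.obar = ob → S.r ≤ r₀ → S.hbar ≤ h₀ →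
      (∀ ψ : E, ‖ψ‖ = 1 → EΛ ≤ (⟪ψ, S.hamiltonian ψ⟫_ℂ).re) →
      N₀ ≤ Fintype.card Λ →
      ∀ ΦB : E, ‖ΦB‖ = 1 →
        (∀ ψ : E, ‖ψ‖ = 1 →
          (⟪ΦB, (S.hamiltonian - (B : ℂ) • S.order 0) ΦB⟫_ℂ).re ≤
            (⟪ψ, (S.hamiltonian - (B : ℂ) • S.order 0) ψ⟫_ℂ).re) →
        Real.sqrt 3 * μ * ob - ε ≤ (⟪ΦB, S.order 0 ΦB⟫_ℂ).re / Fintype.card Λ := by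
  by_cases hμ : 0 < μ
  swap
  · refine ⟨0, ?_⟩
    intro Λ _ _ E _ _ _ S d Φ EΛ hΦ
    exact absurd hΦ.mu_pos hμ
  -- `k` from the `√3` trial-state half (Theorem 6.1 + (7.25)–(7.26)) with `ε/2`
  obtain ⟨k₀, hk₀⟩ := theorem_2_5_orderOne_su2_holds.{u, v} μ ob (ε / 2) (half_pos hε)
  obtain ⟨N₁, hN₁⟩ := hk₀ (max k₀ 1) (le_max_left _ _)
  set k : ℕ := max k₀ 1 with hk_def
  have hk1 : 1 ≤ k := le_max_right _ _
  -- the `N`-uniform energy constant of the class, the size condition, the `ε/2` condition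
  set D : ℝ := (k : ℝ) * 2 ^ (k + 1) * h₀ * r₀ / μ ^ k with hD_def
  set N₂ : ℕ := ⌈(k : ℝ) ^ 2 * 2 ^ k / μ ^ (2 * k)⌉₊ with hN₂_def
  set N₃ : ℕ := ⌈2 * D / (B * ε)⌉₊ with hN₃_def
  refine ⟨max N₁ (max N₂ N₃), ?_⟩
  intro Λ _ _ E _ _ _ S d Φ EΛ hΦ hJ hob hr hh hground hN ΦB hΦB hmin
  have hN0 : (0 : ℝ) < Fintype.card Λ := Nat.cast_pos.mpr Fintype.card_pos
  have hNle1 : N₁ ≤ Fintype.card Λ := le_trans (le_max_left _ _) hN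
  have hNle2 : (N₂ : ℝ) ≤ Fintype.card Λ := by
    exact_mod_cast le_trans (le_trans (le_max_left _ _) (le_max_right _ _)) hN
  have hNle3 : (N₃ : ℝ) ≤ Fintype.card Λ := by
    exact_mod_cast le_trans (le_trans (le_max_right _ _) (le_max_right _ _)) hN
  -- the size condition `k² 2^k ≤ μ^{2k} N`
  have hsize : (k : ℝ) ^ 2 * 2 ^ k ≤ μ ^ (2 * k) * Fintype.card Λ := by
    have hμk : 0 < μ ^ (2 * k) := pow_pos hμ _
    have h1 : (k : ℝ) ^ 2 * 2 ^ k / μ ^ (2 * k) ≤ Fintype.card Λ := (Nat.le_ceil _).trans hNle2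
    rw [div_le_iff₀ hμk] at h1
    calc (k : ℝ) ^ 2 * 2 ^ k ≤ Fintype.card Λ * μ ^ (2 * k) := h1
      _ = μ ^ (2 * k) * Fintype.card Λ := mul_comm _ _
  -- Theorem 7.3 in finite volume (the field transfer) and the `√3` trial-state half
  classical
  have hfin := S.field_order_ge_xiState_of_card_ge hΦ hground hk1 hsize hB hΦB hmin
  have hx := hN₁ S d Φ EΛ hΦ hJ hob hNle1
  -- `D_S ≤ D`
  have hhb : 0 ≤ S.hbar := (norm_nonneg _).trans (S.norm_h_le (Classical.arbitrary Λ))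
  have hDsys : (k : ℝ) * 2 ^ (k + 1) * S.hbar * S.r / μ ^ k ≤ D := by
    rw [hD_def]
    apply div_le_div_of_nonneg_right _ (pow_pos hμ _).le
    have hr' : (S.r : ℝ) ≤ r₀ := by exact_mod_cast hr
    have hprod : S.hbar * S.r ≤ h₀ * r₀ :=
      calc S.hbar * S.r ≤ S.hbar * r₀ := mul_le_mul_of_nonneg_left hr' hhb
        _ ≤ h₀ * r₀ := mul_le_mul_of_nonneg_right hh (Nat.cast_nonneg _)
    calc (k : ℝ) * 2 ^ (k + 1) * S.hbar * S.r = (k : ℝ) * 2 ^ (k + 1) * (S.hbar * S.r) := by ring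
      _ ≤ (k : ℝ) * 2 ^ (k + 1) * (h₀ * r₀) := mul_le_mul_of_nonneg_left hprod (by positivity)
      _ = (k : ℝ) * 2 ^ (k + 1) * h₀ * r₀ := by ring
  -- `D/B ≤ (ε/2) N`
  have hD0 : 0 ≤ D := le_trans (by positivity) hDsys
  have hDN : D / B ≤ ε / 2 * Fintype.card Λ := by
    have h1 : 2 * D / (B * ε) ≤ Fintype.card Λ := (Nat.le_ceil _).trans hNle3
    rw [div_le_iff₀ (mul_pos hB hε)] at h1
    rw [div_le_iff₀ hB]
    nlinarith
  -- assemble: `(√3μo - ε)N ≤ (√3μo - ε/2)N - D/B ≤ Re⟨Ξ,O¹Ξ⟩ - D_S/B ≤ Re⟨Φ_B, O¹Φ_B⟩`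
  rw [le_div_iff₀ hN0]
  rw [le_div_iff₀ hN0] at hx
  have hDB := div_le_div_of_nonneg_right hDsys hB.le
  linarith

/-- **KT93 Corollary 7.2 along a sequence of lattices** (`N_j → ∞`, `U(1)` systems of one class with
`SU(2)` data, on each a ground state `Φ_j` with obscured symmetry breaking annihilated by `X^{(1)}, X^{(2)}`
and a sourced ground state `Φ_j(B)`): for every `B > 0` and `ε > 0`, eventually
`N_j⁻¹ Re⟨Φ_j(B), O^{(1)}_j Φ_j(B)⟩ ≥ √3 μ o - ε`, i.e. `liminf_j N_j⁻¹(Φ_j(B), O^{(1)}_jΦ_j(B)) ≥ √3 σ`.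
[cite: KomaTasaki1993, Corollary 7.2 (7.3)] -/
theorem komaTasakiSU2Field_seq (Λ : ℕ → Type u) [∀ j, Fintype (Λ j)] [∀ j, Nonempty (Λ j)]
    (E : ℕ → Type v) [∀ j, NormedAddCommGroup (E j)] [∀ j, InnerProductSpace ℂ (E j)]
    [∀ j, FiniteDimensional ℂ (E j)] (S : ∀ j, U1System (Λ j) (E j)) (d : ∀ j, SU2Datum (S j))
    (Φ : ∀ j, E j) (EΛ : ℕ → ℝ) (μ ob h₀ : ℝ) (r₀ : ℕ)
    (hΦ : ∀ j, IsLROEigenstate (S j) (Φ j) (EΛ j) μ) (hJ : ∀ j a, (d j).J a (Φ j) = 0)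
    (hob : ∀ j, (S j).obar = ob) (hr : ∀ j, (S j).r ≤ r₀) (hh : ∀ j, (S j).hbar ≤ h₀)
    (hground : ∀ j (ψ : E j), ‖ψ‖ = 1 → EΛ j ≤ (⟪ψ, (S j).hamiltonian ψ⟫_ℂ).re)
    (hN : Tendsto (fun j => Fintype.card (Λ j)) atTop atTop) {B : ℝ} (hB : 0 < B)
    (ΦB : ∀ j, E j) (hΦB : ∀ j, ‖ΦB j‖ = 1)
    (hmin : ∀ j (ψ : E j), ‖ψ‖ = 1 →
      (⟪ΦB j, ((S j).hamiltonian - (B : ℂ) • (S j).order 0) (ΦB j)⟫_ℂ).re ≤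
        (⟪ψ, ((S j).hamiltonian - (B : ℂ) • (S j).order 0) ψ⟫_ℂ).re) :
    ∀ ε : ℝ, 0 < ε → ∀ᶠ j in atTop,
      Real.sqrt 3 * μ * ob - ε ≤ (⟪ΦB j, (S j).order 0 (ΦB j)⟫_ℂ).re / Fintype.card (Λ j) := by
  intro ε hε
  obtain ⟨N₀, hN₀⟩ := komaTasakiSU2Field.{u, v} μ ob h₀ r₀ hB hε
  filter_upwards [Filter.tendsto_atTop.mp hN N₀] with j hj
  exact hN₀ (S j) (d j) (Φ j) (EΛ j) (hΦ j) (hJ j) (hob j) (hr j) (hh j) (hground j) hj (ΦB j)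
    (hΦB j) (hmin j)

/-- **Corollary 7.2 versus Theorem 7.3 on the same system**: the `SU(2)` datum improves the `U(1)` field
bound `√2 μ o - ε` (`komaTasakiU1Field_u1`) to `√3 μ o - ε`; both hold, and `√2 μ o ≤ √3 μ o` for
`μ, o ≥ 0` (KT93 p. 209: "An extra assumption needed in the improvement is i'')").
[cite: KomaTasaki1993, Corollary 7.2 and Theorem 7.3] -/
theorem sqrt_two_mul_le_sqrt_three_mul {μ ob : ℝ} (hμ : 0 ≤ μ) (hob : 0 ≤ ob) :
    Real.sqrt 2 * μ * ob ≤ Real.sqrt 3 * μ * ob := by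
  have h : Real.sqrt 2 ≤ Real.sqrt 3 := Real.sqrt_le_sqrt (by norm_num)
  have hμo : 0 ≤ μ * ob := mul_nonneg hμ hob
  nlinarith

end Literature.MathematicalPhysics.QuantumLattice.KomaTasaki
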